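import Summits.BirchSwinnertonDyer.BirchSwinnertonDyer.Theorems.KolyvaginRoadThreeZhangInduction
import HarnessLib

/-!
# Route `KolyvaginRoadThree`, deciding crux `ZhangSharpFrameAtThreeHL` (item stmt-BirchSwinnertonDyer-19574):
# W. Zhang's induction needs PARITY ONLY AT THE STARTING LEVEL — the input (A6)∕(A6⁰) «odd ∕ non-zero Selmer rank
# at EVERY even level» is idle above the bottom level
# (cell `bsd-stepL`, seat `bsd-stepL-koly3a` g0, ACCEL-LIST (9); `--supports stmt-BirchSwinnertonDyer-19574`, helper)

HONEST FRAMING. Pure linear algebra; no definition, no named fact, no `sorry`; nothing about elliptic curves is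
asserted; nothing is booked. The tree's engines (`ZhangInduction.exists_ne_zero_of_zhangInduction[_of_rank_ne_zero]`,
zhang3-p1 p446019 ∕ p446227; `ZhangInductionOn.…_fin…`, p455609) conclude «at EVERY even level some class is
non-zero» and accordingly consume (A6) «the Selmer rank is odd at EVERY even level» or (A6⁰) «non-zero at every even
level» — at `p = 3` above level `∅` this is the rank-0 converse for LEVEL-RAISED forms (koly R-SU3 + B♭; the
registered stub A `stub_levelRaisingAtThree` of crux 19574 carries it as its second conjunct, flagged «hardest» in
koly's card). OBSERVATION made kernel here: the crux needs the conclusion AT THE BOTTOM LEVEL ONLY, and along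
Zhang's descent `n ↦ n ∪ {q₁, q₂}` the rank drops by EXACTLY two ((A1)'s bookkeeping (9.1)–(9.2)), so ODDNESS OF
THE RANK PROPAGATES from the starting level to every level the induction visits. Hence:

* `exists_ne_zero_of_zhangInduction_fin_oddStart` — (A1) (all levels), (A2) (even levels), (A3) WITH finiteness
  (zhang3's repaired shape), (A4), (A5), and `Odd (rank at n₀)` for ONE even level `n₀` ⟹ some class `κ m n₀ ≠ 0`.
  No parity ∕ non-vanishing hypothesis at any other level.
* `kolyvaginClass_one_ne_zero_of_zhangInduction_oddStart_at` — the one-frame composition at a prime `p` with the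
  bottom classes realised (`hreal`), needing only `Odd (rank at ∅)`.

For 19574 this means: stub A's conjunct (A6⁰) can be REPLACED by «dim_𝔽₃ Sel₃(E/K) is odd» at the frame — on a
Hoffstein–Luo A1 frame (r_an(E/K) = 1) a consequence of PUBLISHED results (Gross–Zagier + Kolyvagin: rank E(K) = 1
and Ш(E/K)[3^∞] finite; Cassels–Tate alternating ⟹ dim Ш[3] even; E(K)[3] = 0 from surjectivity) — see the
companion `Theorems/KolyvaginRoadThreeMethod2CruxOfOddRank.lean`. The deep rank-0 converse then enters the crux ONLY
through stub B's base case (A5) (Zhang Thm 7.2), as in print. PARTITION: O2@3 (B10) × A1 × crux 19574 — none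
(composition-engine refinement; types nothing, closes nothing; T7).

References: [cite: WZhang2014, §9 proof of Thm. 9.1 (pp. 240–242), Thm. 9.2, Lemma 8.4, Prop. 5.4, Thm. 4.3, Thm. 7.2].
-/

namespace Summit.BirchSwinnertonDyer.Rank1Residual.X11b.Three.Koly.ZhangInduction

open Module

variable {F : Type*} [Field F] {H : Type*} [AddCommGroup H] [Module F H]
  {Q : Type*} [DecidableEq Q] {M : Type*}

/-- A submodule of positive dimension has a non-zero element. [folklore] -/
private theorem exists_mem_ne_zero_of_finrank_pos' {S : Submodule F H} (h : 0 < finrank F S) :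
    ∃ c ∈ S, c ≠ 0 := by
  by_contra hc
  push Not at hc
  have hbot : S = ⊥ := (Submodule.eq_bot_iff S).mpr hc
  rw [hbot, finrank_bot] at h
  exact lt_irrefl 0 h

omit [DecidableEq Q] in
/-- The total rank does not depend on which eigenspace is listed first. [folklore] -/
private theorem rank_symm' (Sel : Finset Q → Bool → Submodule F H) (n : Finset Q) (μ : Bool) :
    finrank F (Sel n μ) + finrank F (Sel n (!μ)) = finrank F (Sel n true) + finrank F (Sel n false) := by
  cases μ
  · rw [Bool.not_false, add_comm]
  · rw [Bool.not_true]

set_option maxHeartbeats 400000 in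
/-- **W. Zhang's induction with parity ONLY AT THE START.** Data as in the tree's engines (eigen-Selmer spaces
`Sel n μ`, relaxed spaces `SelRel`, base locus `B`, classes `κ`, bottom index `m₁`). Hypotheses: (A1) rank lowering
with the (9.1)–(9.2) bookkeeping (all levels); (A2) congruence transport at EVEN levels; (A3) triangulation WITH the
finiteness of the relaxed `−s`-eigenspace (zhang3-p1's repaired shape); (A4) relaxation; (A5) base case. Conclusion:
at every even level `n₀` whose total rank is ODD, some class `κ m n₀` is non-zero. Proof = Zhang's (strong induction
on the rank `k`), carrying «`k` odd» through the descent: from an even level of odd rank `k ≥ 3` the two lowerings of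
(A1) in the larger eigenspace reach the even level `n ∪ {q₁, q₂}` of rank EXACTLY `k − 2` — odd again — so no parity
or non-vanishing input is consulted anywhere else. [cite: WZhang2014, §9 proof of Thm. 9.1 and Thm. 9.2] -/
theorem exists_ne_zero_of_zhangInduction_fin_oddStart
    (Sel : Finset Q → Bool → Submodule F H) (SelRel : Finset Q → Set Q → Bool → Submodule F H)
    (B : Finset Q → Set Q) (κ : M → Finset Q → H) (m₁ : M)
    -- (A1) rank lowering at one new prime, eigen-bookkeeping (9.1)–(9.2)
    (hA1 : ∀ (n : Finset Q) (μ : Bool) (c : H), c ∈ Sel n μ → c ≠ 0 →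
      ∃ q, q ∉ n ∧ c ∉ Sel (insert q n) μ ∧ Sel (insert q n) μ ≤ Sel n μ ∧
        finrank F (Sel (insert q n) μ) + 1 = finrank F (Sel n μ) ∧ Sel (insert q n) (!μ) = Sel n (!μ))
    -- (A2) congruence transport, at EVEN levels
    (hA2 : ∀ (n : Finset Q), Even n.card → ∀ (q₁ q₂ : Q), q₁ ∉ n → q₂ ∉ insert q₁ n →
      q₂ ∉ B (insert q₂ (insert q₁ n)) → ∃ m, κ m n ≠ 0)
    -- (A3) triangulation with finiteness of the relaxed (−s)-eigenspace
    (hA3 : ∀ (n : Finset Q), Even n.card → (∃ m, κ m n ≠ 0) →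
      ∃ (s : Bool) (d : ℕ), finrank F (Sel n s) = d + 1 ∧ Sel n s = SelRel n (B n) s ∧
        FiniteDimensional F (SelRel n (B n) (!s)) ∧ finrank F (SelRel n (B n) (!s)) ≤ d)
    -- (A4) relaxation
    (hA4 : ∀ (n : Finset Q) (q : Q) (S : Set Q) (s : Bool), q ∉ n → q ∈ S → Sel n s ≤ SelRel (insert q n) S s)
    -- (A5) base case
    (hA5 : ∀ (n : Finset Q), Even n.card → finrank F (Sel n true) + finrank F (Sel n false) = 1 → κ m₁ n ≠ 0) :
    ∀ (n : Finset Q), Even n.card → Odd (finrank F (Sel n true) + finrank F (Sel n false)) → ∃ m, κ m n ≠ 0 := by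
  -- strong induction on the (odd) Selmer rank `k`
  suffices hmain : ∀ (k : ℕ) (n : Finset Q), finrank F (Sel n true) + finrank F (Sel n false) = k →
      Even n.card → Odd k → ∃ m, κ m n ≠ 0 from fun n hn hodd ↦ hmain _ n rfl hn hodd
  intro k
  induction k using Nat.strong_induction_on with
  | _ k ih =>
    intro n hk hn hodd
    by_cases h1 : finrank F (Sel n true) + finrank F (Sel n false) = 1
    · exact ⟨m₁, hA5 n hn h1⟩
    -- k ≥ 3; choose the larger eigenspace μ
    have h3 : 3 ≤ finrank F (Sel n true) + finrank F (Sel n false) := by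
      obtain ⟨t, ht⟩ := hodd
      omega
    obtain ⟨μ, hμ⟩ : ∃ μ : Bool, finrank F (Sel n (!μ)) < finrank F (Sel n μ) := by
      by_cases hlt : finrank F (Sel n false) < finrank F (Sel n true)
      · exact ⟨true, by rw [Bool.not_true]; exact hlt⟩
      · refine ⟨false, ?_⟩
        have hne : finrank F (Sel n true) ≠ finrank F (Sel n false) := by
          intro heq
          obtain ⟨t, ht⟩ := hodd
          omega
        rw [Bool.not_false]
        omega
    have hsum := rank_symm' Sel n μ
    have hμ2 : 2 ≤ finrank F (Sel n μ) := by omega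
    -- two rank lowerings inside the μ-eigenspace
    obtain ⟨c₁, hc₁, hc₁0⟩ := exists_mem_ne_zero_of_finrank_pos' (S := Sel n μ) (by omega)
    obtain ⟨q₁, hq₁n, -, -, hrk₁, hneg₁⟩ := hA1 n μ c₁ hc₁ hc₁0
    obtain ⟨c₂, hc₂, hc₂0⟩ := exists_mem_ne_zero_of_finrank_pos' (S := Sel (insert q₁ n) μ) (by omega)
    obtain ⟨q₂, hq₂n, hc₂out, hle₂, hrk₂, hneg₂⟩ := hA1 (insert q₁ n) μ c₂ hc₂ hc₂0
    set n₁ := insert q₁ n with hn₁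
    set n₂ := insert q₂ n₁ with hn₂
    have hcard : n₂.card = n.card + 2 := by
      rw [hn₂, Finset.card_insert_of_notMem hq₂n, hn₁, Finset.card_insert_of_notMem hq₁n]
    have hn₂even : Even n₂.card := by
      obtain ⟨t, ht⟩ := hn
      exact ⟨t + 1, by rw [hcard]; omega⟩
    have hsum₂ := rank_symm' Sel n₂ μ
    -- the new rank is EXACTLY k − 2, hence odd again: parity propagates
    have hrank₂ : finrank F (Sel n₂ true) + finrank F (Sel n₂ false) + 2 = k := by
      rw [← hsum₂, hneg₂, hneg₁, ← hk, ← hsum]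
      omega
    have hodd₂ : Odd (finrank F (Sel n₂ true) + finrank F (Sel n₂ false)) := by
      obtain ⟨t, ht⟩ := hodd
      exact ⟨t - 1, by omega⟩
    obtain ⟨m', hm'⟩ := ih _ (by omega) n₂ rfl hn₂even hodd₂
    -- transport down by (A2) unless q₂ is a base point upstairs
    refine hA2 n hn q₁ q₂ hq₁n hq₂n fun hq₂B ↦ ?_
    obtain ⟨s, d, hs1, hs2, hsfin, hs3⟩ := hA3 n₂ hn₂even ⟨m', hm'⟩
    by_cases hsμ : s = μ
    · -- case (1): the killed class c₂ would survive
      subst hsμ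
      have hincl : Sel n₁ s ≤ SelRel n₂ (B n₂) s := hA4 n₁ q₂ (B n₂) s hq₂n hq₂B
      exact hc₂out (hs2 ▸ hincl hc₂)
    · -- case (2): dimension count (9.1)–(9.4)
      have hs : s = !μ := by cases s <;> cases μ <;> simp_all
      subst hs
      have hincl : Sel n₁ μ ≤ SelRel n₂ (B n₂) μ := hA4 n₁ q₂ (B n₂) μ hq₂n hq₂B
      haveI : FiniteDimensional F (SelRel n₂ (B n₂) μ) := by rw [Bool.not_not] at hsfin; exact hsfin
      have hle : finrank F (Sel n₁ μ) ≤ finrank F (SelRel n₂ (B n₂) μ) := Submodule.finrank_mono hincl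
      have hs3' : finrank F (SelRel n₂ (B n₂) μ) ≤ d := by rw [Bool.not_not] at hs3; exact hs3
      rw [hneg₂, hneg₁] at hs1
      omega

/-- **One-frame composition with parity only at the bottom.** At a frame `(W, K, Dt, β, ι)` and a prime `p`: Zhang
data with (A1), (A2) at even levels, (A3) with finiteness, (A4), (A5), whose level-`∅` rank is ODD and whose
non-zero bottom classes are realised by genuine Kolyvagin classes `d.kolyvaginClass hp 1` of Kolyvagin-prime support
(`hreal`), give a non-zero mod-`p` Kolyvagin class on the frame — the frame-wise body of
`Theses.KolyvaginRoadThree.ZhangSharpFrameAtThreeHL` at `p = 3`. No (A6)∕(A6⁰) above level `∅`. CONDITIONAL on every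
binder; nothing is booked. [cite: WZhang2014, Thm. 9.1, Thm. 9.3] -/
theorem kolyvaginClass_one_ne_zero_of_zhangInduction_oddStart_at
    (W : WeierstrassCurve ℚ) [W.IsElliptic] [W.IsGloballyMinimal] [NeZero (W.conductorNorm ℤ)]
    (K : Type) [Field K] [NumberField K]
    (Dt : Literature.NumberTheory.EllipticCurves.ModularForms.ModularParametrizationData W (W.conductorNorm ℤ))
    (β : ℤ) (ι : K →+* ℂ) {p : ℕ} (hp : p.Prime)
    (Sel : Finset Q → Bool → Submodule F H) (SelRel : Finset Q → Set Q → Bool → Submodule F H)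
    (B : Finset Q → Set Q) (κ : M → Finset Q → H) (m₁ : M)
    (hA1 : ∀ (n : Finset Q) (μ : Bool) (c : H), c ∈ Sel n μ → c ≠ 0 →
      ∃ q, q ∉ n ∧ c ∉ Sel (insert q n) μ ∧ Sel (insert q n) μ ≤ Sel n μ ∧
        finrank F (Sel (insert q n) μ) + 1 = finrank F (Sel n μ) ∧ Sel (insert q n) (!μ) = Sel n (!μ))
    (hA2 : ∀ (n : Finset Q), Even n.card → ∀ (q₁ q₂ : Q), q₁ ∉ n → q₂ ∉ insert q₁ n →
      q₂ ∉ B (insert q₂ (insert q₁ n)) → ∃ m, κ m n ≠ 0)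
    (hA3 : ∀ (n : Finset Q), Even n.card → (∃ m, κ m n ≠ 0) →
      ∃ (s : Bool) (d : ℕ), finrank F (Sel n s) = d + 1 ∧ Sel n s = SelRel n (B n) s ∧
        FiniteDimensional F (SelRel n (B n) (!s)) ∧ finrank F (SelRel n (B n) (!s)) ≤ d)
    (hA4 : ∀ (n : Finset Q) (q : Q) (S : Set Q) (s : Bool), q ∉ n → q ∈ S → Sel n s ≤ SelRel (insert q n) S s)
    (hA5 : ∀ (n : Finset Q), Even n.card → finrank F (Sel n true) + finrank F (Sel n false) = 1 → κ m₁ n ≠ 0)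
    -- parity at the bottom only
    (hodd : Odd (finrank F (Sel ∅ true) + finrank F (Sel ∅ false)))
    -- realisation of the bottom classes as the frame's Kolyvagin classes mod p
    (hreal : ∀ m, κ m ∅ ≠ 0 →
      ∃ (n : ℕ) (d : Literature.NumberTheory.EllipticCurves.KolyvaginHeegnerData Dt β ι n),
        Literature.NumberTheory.EllipticCurves.KolyvaginDescent.KolSupp
            (Literature.NumberTheory.EllipticCurves.Zhang2014.IsKolyvaginPrime (W.conductorNorm ℤ) W K p) n ∧
          d.kolyvaginClass hp 1 ≠ 0) :
    ∃ (n : ℕ) (d : Literature.NumberTheory.EllipticCurves.KolyvaginHeegnerData Dt β ι n),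
      Literature.NumberTheory.EllipticCurves.KolyvaginDescent.KolSupp
          (Literature.NumberTheory.EllipticCurves.Zhang2014.IsKolyvaginPrime (W.conductorNorm ℤ) W K p) n ∧
        d.kolyvaginClass hp 1 ≠ 0 := by
  obtain ⟨m, hm⟩ := exists_ne_zero_of_zhangInduction_fin_oddStart Sel SelRel B κ m₁ hA1 hA2 hA3 hA4 hA5 ∅ (by simp)
    hodd
  exact hreal m hm

/-! ## The same on GOOD levels (the registered skeleton v2u relativises every level to `GoodLevel`) -/

set_option maxHeartbeats 400000 in
/-- **Zhang's induction with parity ONLY AT THE START, relativised to GOOD levels** (the shape of the tree's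
`ZhangInductionOn.exists_ne_zero_of_zhangInduction_on…`, zhang3-p1 p455609, used by the registered skeleton v2u of
crux 19574 whose stubs quantify over `GoodLevel W K n`): (A1) lowers at a fresh prime staying inside the good levels,
(A2) along two good steps, (A3) with finiteness ∕ (A5) at good even levels, (A4) between good levels; conclusion: at
every GOOD even level `n₀` of ODD total rank some class `κ m n₀` is non-zero. No parity ∕ non-vanishing hypothesis at
any other level: the rank drops by exactly two along the descent, and the levels reached stay good by (A1).
[cite: WZhang2014, §9 proof of Thm. 9.1 and Thm. 9.2] -/
theorem exists_ne_zero_of_zhangInduction_on_oddStart (Good : Finset Q → Prop)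
    (Sel : Finset Q → Bool → Submodule F H) (SelRel : Finset Q → Set Q → Bool → Submodule F H)
    (B : Finset Q → Set Q) (κ : M → Finset Q → H) (m₁ : M)
    (hA1 : ∀ (n : Finset Q) (μ : Bool) (c : H), Good n → c ∈ Sel n μ → c ≠ 0 →
      ∃ q, q ∉ n ∧ Good (insert q n) ∧ c ∉ Sel (insert q n) μ ∧ Sel (insert q n) μ ≤ Sel n μ ∧
        finrank F (Sel (insert q n) μ) + 1 = finrank F (Sel n μ) ∧ Sel (insert q n) (!μ) = Sel n (!μ))
    (hA2 : ∀ (n : Finset Q) (q₁ q₂ : Q), Good n → Good (insert q₁ n) → Good (insert q₂ (insert q₁ n)) →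
      q₁ ∉ n → q₂ ∉ insert q₁ n → q₂ ∉ B (insert q₂ (insert q₁ n)) → ∃ m, κ m n ≠ 0)
    (hA3 : ∀ (n : Finset Q), Good n → Even n.card → (∃ m, κ m n ≠ 0) →
      ∃ (s : Bool) (d : ℕ), finrank F (Sel n s) = d + 1 ∧ Sel n s = SelRel n (B n) s ∧
        FiniteDimensional F (SelRel n (B n) (!s)) ∧ finrank F (SelRel n (B n) (!s)) ≤ d)
    (hA4 : ∀ (n : Finset Q) (q : Q) (S : Set Q) (s : Bool), Good n → Good (insert q n) → q ∉ n → q ∈ S →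
      Sel n s ≤ SelRel (insert q n) S s)
    (hA5 : ∀ (n : Finset Q), Good n → Even n.card →
      finrank F (Sel n true) + finrank F (Sel n false) = 1 → κ m₁ n ≠ 0) :
    ∀ (n : Finset Q), Good n → Even n.card → Odd (finrank F (Sel n true) + finrank F (Sel n false)) →
      ∃ m, κ m n ≠ 0 := by
  suffices hmain : ∀ (k : ℕ) (n : Finset Q), Good n → finrank F (Sel n true) + finrank F (Sel n false) = k →
      Even n.card → Odd k → ∃ m, κ m n ≠ 0 from fun n hg hn hodd ↦ hmain _ n hg rfl hn hodd
  intro k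
  induction k using Nat.strong_induction_on with
  | _ k ih =>
    intro n hg hk hn hodd
    by_cases h1 : finrank F (Sel n true) + finrank F (Sel n false) = 1
    · exact ⟨m₁, hA5 n hg hn h1⟩
    have h3 : 3 ≤ finrank F (Sel n true) + finrank F (Sel n false) := by
      obtain ⟨t, ht⟩ := hodd
      omega
    obtain ⟨μ, hμ⟩ : ∃ μ : Bool, finrank F (Sel n (!μ)) < finrank F (Sel n μ) := by
      by_cases hlt : finrank F (Sel n false) < finrank F (Sel n true)
      · exact ⟨true, by rw [Bool.not_true]; exact hlt⟩
      · refine ⟨false, ?_⟩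
        have hne : finrank F (Sel n true) ≠ finrank F (Sel n false) := by
          intro heq
          obtain ⟨t, ht⟩ := hodd
          omega
        rw [Bool.not_false]
        omega
    have hsum := rank_symm' Sel n μ
    have hμ2 : 2 ≤ finrank F (Sel n μ) := by omega
    obtain ⟨c₁, hc₁, hc₁0⟩ := exists_mem_ne_zero_of_finrank_pos' (S := Sel n μ) (by omega)
    obtain ⟨q₁, hq₁n, hg₁, -, -, hrk₁, hneg₁⟩ := hA1 n μ c₁ hg hc₁ hc₁0
    obtain ⟨c₂, hc₂, hc₂0⟩ := exists_mem_ne_zero_of_finrank_pos' (S := Sel (insert q₁ n) μ) (by omega)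
    obtain ⟨q₂, hq₂n, hg₂, hc₂out, hle₂, hrk₂, hneg₂⟩ := hA1 (insert q₁ n) μ c₂ hg₁ hc₂ hc₂0
    set n₁ := insert q₁ n with hn₁
    set n₂ := insert q₂ n₁ with hn₂
    have hcard : n₂.card = n.card + 2 := by
      rw [hn₂, Finset.card_insert_of_notMem hq₂n, hn₁, Finset.card_insert_of_notMem hq₁n]
    have hn₂even : Even n₂.card := by
      obtain ⟨t, ht⟩ := hn
      exact ⟨t + 1, by rw [hcard]; omega⟩
    have hsum₂ := rank_symm' Sel n₂ μ
    have hrank₂ : finrank F (Sel n₂ true) + finrank F (Sel n₂ false) + 2 = k := by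
      rw [← hsum₂, hneg₂, hneg₁, ← hk, ← hsum]
      omega
    have hodd₂ : Odd (finrank F (Sel n₂ true) + finrank F (Sel n₂ false)) := by
      obtain ⟨t, ht⟩ := hodd
      exact ⟨t - 1, by omega⟩
    obtain ⟨m', hm'⟩ := ih _ (by omega) n₂ hg₂ rfl hn₂even hodd₂
    refine hA2 n q₁ q₂ hg hg₁ hg₂ hq₁n hq₂n fun hq₂B ↦ ?_
    obtain ⟨s, d, hs1, hs2, hsfin, hs3⟩ := hA3 n₂ hg₂ hn₂even ⟨m', hm'⟩
    by_cases hsμ : s = μ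
    · subst hsμ
      have hincl : Sel n₁ s ≤ SelRel n₂ (B n₂) s := hA4 n₁ q₂ (B n₂) s hg₁ hg₂ hq₂n hq₂B
      exact hc₂out (hs2 ▸ hincl hc₂)
    · have hs : s = !μ := by cases s <;> cases μ <;> simp_all
      subst hs
      have hincl : Sel n₁ μ ≤ SelRel n₂ (B n₂) μ := hA4 n₁ q₂ (B n₂) μ hg₁ hg₂ hq₂n hq₂B
      haveI : FiniteDimensional F (SelRel n₂ (B n₂) μ) := by rw [Bool.not_not] at hsfin; exact hsfin
      have hle : finrank F (Sel n₁ μ) ≤ finrank F (SelRel n₂ (B n₂) μ) := Submodule.finrank_mono hincl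
      have hs3' : finrank F (SelRel n₂ (B n₂) μ) ≤ d := by rw [Bool.not_not] at hs3; exact hs3
      rw [hneg₂, hneg₁] at hs1
      omega

end Summit.BirchSwinnertonDyer.Rank1Residual.X11b.Three.Koly.ZhangInduction
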